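import Summits.Ventures.YMGap.RobustBall.TruncatedSplitBall
import Summits.Ventures.YMGap.Thresholds.CumulantCalculus
import HarnessLib

/-!
# Venture YMGap, track ROBUST-BALL (Y2) — «C-SMOOTH-BALL» (ii-P), DOOR-AGNOSTIC CORE WITH AN ABSTRACT SLOT INDEX: DECAY OF THE TRUNCATED FUNCTIONS
# OF EVERY ORDER FOR SLOT FAMILIES INDEXED BY ANY TYPE `P` WITH A SUPPORT MAP (the mixed-direction generalisation of `TruncatedDecayBall`)

HONEST FRAMING. WHAT THIS IS: a venture file (cell `pub-ymgap`, track Y2 ROBUST-BALL, seat rb-p1, theorems only), the verbatim generalisation of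
`TruncatedDecayBall.abs_trunc_le_of_covDecay` from slot families indexed by link sets (`V_X`, support `X`) to slot families `V_p` indexed by an
arbitrary type `P` with a support map `supp : P → Finset (links)` (`V_p` local on `supp p`, Frobenius-Lipschitz vector `lipV_p`, diameter majorant
`dia p`).  Purpose: SEVERAL directions at once (`P = ι × Finset (links)`, `V_(j,X) = (V_j)_X`) — the input of joint (multi-parameter) smoothness.
* `abs_trunc_le_of_covDecay_P` — a probability measure with the covariance-decay property (`C_cov`, rate `t ≥ 0`), `F` bounded measurable local
  Frobenius-Lipschitz on `Λ_F`: for every `n` and `q : Fin n → P`,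
  `|u_{n+1}(F; V^c_{q 0}; …; V^c_{q (n−1)})_μ| ≤ cumBound(n+1) (1 + C_cov) (M_F + Σδ_F) ∏_i (2√N + 1) S_{q i} e^{(t/n) dia(q i)} e^{−(t/n²) R(supp (q i))}`
  (same radial pigeonhole proof; `TruncatedDecayBall` is the case `P = Finset (links)`, `supp = id`).
WHAT THIS IS NOT: tree decay proper; nothing continuum / Clay.
-/

noncomputable section

open MeasureTheory Function Finset ProbabilityTheory Real
open scoped NNReal
open Literature.Probability.LatticeModels
open Literature.Probability.LatticeModels.DobrushinMetric
open Literature.MathematicalPhysics.QuantumLattice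
open Literature.MathematicalPhysics.QuantumFieldTheory hiding ZdEdge
open Summit.Ventures.YMGap.Cumulants

namespace Summit.Ventures.YMGap.RobustBall

variable {d N : ℕ}

/-! ### The slot family of `F` and `n` centred terms of the direction -/

section SlotData

variable {G P : Type*} {supp : P → Finset (ZdEdge d)} {F : (ZdEdge d → G) → ℝ} {V : P → (ZdEdge d → G) → ℝ} {ΛF : Finset (ZdEdge d)} {MF : ℝ}
  {MV : P → ℝ} {δF : ZdEdge d → ℝ} {lipV : P → ZdEdge d → ℝ} {r : G → G → ℝ}

/-- The support bookkeeping of the slot family: slot `0 ↦ Λ_F`, slot `i+1 ↦ q i` (`i < n`), junk `∅`. -/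
theorem slots_dependsOn_P {n : ℕ} (q : Fin n → P) (hF : DependsOn F (↑ΛF : Set (ZdEdge d)))
    (hV : ∀ p, DependsOn (V p) (↑(supp p) : Set (ZdEdge d))) {Δs : ℕ → Finset (ZdEdge d)} (h0 : Δs 0 = ΛF)
    (hsucc : ∀ j, Δs (j + 1) = if h : j < n then supp (q ⟨j, h⟩) else ∅) :
    ∀ i, DependsOn (slots F V q i) (↑(Δs i) : Set (ZdEdge d)) := by
  intro i
  cases i with
  | zero => rw [h0]; exact hF
  | succ j =>
    rw [hsucc j]
    by_cases h : j < n
    · rw [slots_succ_of_lt F V q h, dif_pos h]; exact hV _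
    · rw [slots_succ_of_le F V q (not_lt.1 h), dif_neg h]; exact fun _ _ _ => rfl

/-- The bound bookkeeping of the slot family: slot `0 ↦ M_F`, slot `i+1 ↦ MV (q i)`, junk `1`. -/
theorem slots_abs_le_P {n : ℕ} (q : Fin n → P) (hF : ∀ σ, |F σ| ≤ MF) (hV : ∀ p σ, |V p σ| ≤ MV p)
    {Ms : ℕ → ℝ} (h0 : Ms 0 = MF) (hsucc : ∀ j, Ms (j + 1) = if h : j < n then MV (q ⟨j, h⟩) else 1) :
    ∀ i σ, |slots F V q i σ| ≤ Ms i := by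
  intro i σ
  cases i with
  | zero => rw [h0]; exact hF σ
  | succ j =>
    rw [hsucc j]
    by_cases h : j < n
    · rw [slots_succ_of_lt F V q h, dif_pos h]; exact hV _ σ
    · rw [slots_succ_of_le F V q (not_lt.1 h), dif_neg h, abs_one]

/-- The Lipschitz bookkeeping of the slot family: slot `0 ↦ δ_F`, slot `i+1 ↦ lipV (q i)`, junk `0`. -/
theorem slots_isLipBound_P {n : ℕ} (q : Fin n → P) (hF : IsLipBound r F δF) (hV : ∀ p, IsLipBound r (V p) (lipV p))
    {δs : ℕ → ZdEdge d → ℝ} (h0 : δs 0 = δF) (hsucc : ∀ j, δs (j + 1) = if h : j < n then lipV (q ⟨j, h⟩) else fun _ => 0) :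
    ∀ i, IsLipBound r (slots F V q i) (δs i) := by
  intro i
  cases i with
  | zero => rw [h0]; exact hF
  | succ j =>
    rw [hsucc j]
    by_cases h : j < n
    · rw [slots_succ_of_lt F V q h, dif_pos h]; exact hV _
    · rw [slots_succ_of_le F V q (not_lt.1 h), dif_neg h]
      exact ⟨fun _ => le_rfl, fun y σ τ _ => by simp⟩

/-- The measurability bookkeeping of the slot family. -/
theorem slots_measurable_P [MeasurableSpace (ZdEdge d → G)] {n : ℕ} (q : Fin n → P) (hF : Measurable F)
    (hV : ∀ p, Measurable (V p)) : ∀ i, Measurable (slots F V q i) := by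
  intro i
  cases i with
  | zero => exact hF
  | succ j =>
    by_cases h : j < n
    · rw [slots_succ_of_lt F V q h]; exact hV _
    · rw [slots_succ_of_le F V q (not_lt.1 h)]; exact measurable_const

end SlotData

/-! ### Decay of the truncated functions on the ball -/

/-- Local shorthand: the outer radius `R(X) = max_{y ∈ X} dist(y, Λ)` of a link set about `Λ` (`0` for `X = ∅`). -/
local notation3 (prettyPrint := false) "Rad[" Λ "," X "]" =>
  ((Finset.sup X fun y => (linkSetDist Λ y).toNNReal : ℝ≥0) : ℝ)

section SUN

variable {P : Type*} {supp : P → Finset (ZdEdge d)} {V : P → LGConfig d (Matrix.specialUnitaryGroup (Fin N) ℂ) → ℝ}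

set_option maxHeartbeats 800000 in
/-- ★★ **DECAY OF THE TRUNCATED FUNCTIONS OF EVERY ORDER UNDER COVARIANCE DECAY — SLOT FAMILIES OVER AN ABSTRACT INDEX TYPE.**  A probability
measure `μ` with the covariance-decay property (constant `C_cov ≥ 0`, rate `t ≥ 0`); `F` bounded measurable local on `Λ_F` with vector `δ_F`; slot terms
`V_p`, `p : P`, measurable, local on `supp p`, vectors `lipV_p` (`S_p = Σ_{y ∈ supp p} lipV_p y`); `dia` a diameter majorant (`‖y − z‖_∞ ≤ dia p` on
`supp p`).  Then for every `n` and every `q : Fin n → P`: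
`|u_{n+1}(F; V^c_{q 0}; …; V^c_{q (n−1)})_μ| ≤ cumBound(n+1) (1 + C_cov) (M_F + Σ_{Λ_F} δ_F) ∏_i (2√N + 1) S_{q i} e^{(t/n) dia(q i)} e^{−(t/n²) R(supp(q i))}`. -/
theorem abs_trunc_le_of_covDecay_P {μ : Measure (LGConfig d (Matrix.specialUnitaryGroup (Fin N) ℂ))} [IsProbabilityMeasure μ]
    {Ccov t : ℝ} (hCcov : 0 ≤ Ccov) (ht : 0 ≤ t)
    (hCov : ∀ (f g : LGConfig d (Matrix.specialUnitaryGroup (Fin N) ℂ) → ℝ) (Δf Δg : Finset (ZdEdge d)) (Mf Mg : ℝ) (δf δg : ZdEdge d → ℝ),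
      Measurable f → DependsOn f (↑Δf : Set (ZdEdge d)) → (∀ σ, |f σ| ≤ Mf) → IsLipBound suFrobDist f δf →
      Measurable g → DependsOn g (↑Δg : Set (ZdEdge d)) → (∀ σ, |g σ| ≤ Mg) → IsLipBound suFrobDist g δg →
        |cov[f, g; μ]| ≤ Ccov * (∑ y ∈ Δg, δg y) * (∑ y ∈ Δf, δf y) * exp (-(t * setDistEdges Δf Δg)))
    {F : LGConfig d (Matrix.specialUnitaryGroup (Fin N) ℂ) → ℝ} (hFm : Measurable F) {ΛF : Finset (ZdEdge d)}
    (hFdep : DependsOn F (↑ΛF : Set (ZdEdge d))) {MF : ℝ} (hMF : ∀ σ, |F σ| ≤ MF) {δF : ZdEdge d → ℝ} (hδF : IsLipBound suFrobDist F δF)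
    (hVm : ∀ p, Measurable (V p)) (hVdep : ∀ p, DependsOn (V p) (↑(supp p) : Set (ZdEdge d)))
    {lipV : P → ZdEdge d → ℝ} (hlipV : ∀ p, IsLipBound suFrobDist (V p) (lipV p))
    {dia : P → ℝ} (hdia : ∀ p, ∀ y ∈ supp p, ∀ z ∈ supp p, ‖y.1 - z.1‖ ≤ dia p)
    (n : ℕ) (q : Fin n → P) :
    |trunc μ F (fun p σ => V p σ - V p 1) q| ≤
      cumBound (n + 1) * (1 + Ccov) * (MF + ∑ y ∈ ΛF, δF y) *
        ∏ i, ((2 * Real.sqrt N + 1) * (∑ y ∈ supp (q i), lipV (q i) y) * exp (t / n * dia (q i)) *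
          exp (-(t / n ^ 2 * Rad[ΛF, supp (q i)]))) := by
  classical
  -- the centred direction and its data
  set Vc : P → LGConfig d (Matrix.specialUnitaryGroup (Fin N) ℂ) → ℝ := fun p σ => V p σ - V p 1 with hVc
  have hVcm : ∀ p, Measurable (Vc p) := fun p => (hVm p).sub measurable_const
  have hVcdep : ∀ p, DependsOn (Vc p) (↑(supp p) : Set (ZdEdge d)) := fun p => (centred_data (hVdep p) (hlipV p)).1
  have hVclip : ∀ p, IsLipBound suFrobDist (Vc p) (lipV p) := fun p => (centred_data (hVdep p) (hlipV p)).2.1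
  set SV : P → ℝ := fun p => ∑ y ∈ supp p, lipV p y with hSV
  have hSV0 : ∀ p, 0 ≤ SV p := fun p => sum_nonneg fun y _ => (hlipV p).nonneg y
  have hVcb : ∀ p σ, |Vc p σ| ≤ 2 * Real.sqrt N * SV p := fun p => (centred_data (hVdep p) (hlipV p)).2.2
  have hN2 : (0 : ℝ) ≤ 2 * Real.sqrt N := by positivity
  -- slot data
  set Δs : ℕ → Finset (ZdEdge d) := fun i => Nat.casesOn i ΛF fun j => if h : j < n then supp (q ⟨j, h⟩) else ∅ with hΔs
  set Ms : ℕ → ℝ := fun i => Nat.casesOn i MF fun j => if h : j < n then 2 * Real.sqrt N * SV (q ⟨j, h⟩) else 1 with hMs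
  set δs : ℕ → ZdEdge d → ℝ := fun i => Nat.casesOn i δF fun j => if h : j < n then lipV (q ⟨j, h⟩) else fun _ => 0 with hδs
  have hΔ0 : Δs 0 = ΛF := rfl
  have hΔsucc : ∀ j, Δs (j + 1) = if h : j < n then supp (q ⟨j, h⟩) else ∅ := fun _ => rfl
  set X := slots F Vc q with hX
  have hXdep : ∀ i, DependsOn (X i) (↑(Δs i) : Set (ZdEdge d)) := slots_dependsOn_P q hFdep hVcdep (Δs := Δs) rfl fun _ => rfl
  have hXM : ∀ i σ, |X i σ| ≤ Ms i := slots_abs_le_P (MV := fun p => 2 * Real.sqrt N * SV p) q hMF hVcb (Ms := Ms) rfl fun _ => rfl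
  have hXδ : ∀ i, IsLipBound suFrobDist (X i) (δs i) := slots_isLipBound_P q hδF hVclip (δs := δs) rfl fun _ => rfl
  have hXm : ∀ i, Measurable (X i) := slots_measurable_P q hFm hVcm
  set S : Finset ℕ := Finset.range (n + 1) with hS
  -- the weights `bw i = Ms i + Σ δs i`
  set bw : ℕ → ℝ := fun i => Ms i + ∑ y ∈ Δs i, δs i y with hbw
  have hMs0 : ∀ i, 0 ≤ Ms i := fun i => (abs_nonneg _).trans (hXM i 1)
  have hδs0 : ∀ i, 0 ≤ ∑ y ∈ Δs i, δs i y := fun i => sum_nonneg fun y _ => (hXδ i).nonneg y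
  have hbw0 : ∀ i, 0 ≤ bw i := fun i => add_nonneg (hMs0 i) (hδs0 i)
  have hMbw : ∀ i, Ms i ≤ bw i := fun i => le_add_of_nonneg_right (hδs0 i)
  have hmomb : ∀ T ⊆ S, |mom μ X T| ≤ ∏ i ∈ T, bw i := fun T hT =>
    (abs_mom_le μ (b := Ms) (S := S) (fun i _ σ => hXM i σ) T hT).trans
      (prod_le_prod (fun i _ => hMs0 i) fun i _ => hMbw i)
  have hmom1 : mom μ X ∅ = 1 := mom_empty μ X
  -- the product of the weights
  have hbw0' : bw 0 = MF + ∑ y ∈ ΛF, δF y := rfl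
  have hbwsucc : ∀ i : Fin n, bw (i.1 + 1) = (2 * Real.sqrt N + 1) * SV (q i) := fun i => by
    have hi : i.1 < n := i.2
    simp only [hbw, hMs, hΔs, hδs, dif_pos hi, hSV]
    ring
  have hprodS : ∏ i ∈ S, bw i = (MF + ∑ y ∈ ΛF, δF y) * ∏ i : Fin n, (2 * Real.sqrt N + 1) * SV (q i) := by
    rw [hS, Finset.prod_range_succ', hbw0', mul_comm, ← Fin.prod_univ_eq_prod_range (fun j => bw (j + 1)) n]
    congr 1
    exact Fintype.prod_congr _ _ fun i => hbwsucc i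
  have hcardS : S.card = n + 1 := by rw [hS, Finset.card_range]
  -- the crude bound
  have hcrude : |trunc μ F Vc q| ≤ cumBound (n + 1) * ∏ i ∈ S, bw i := by
    have h := abs_ac_le (m := mom μ X) (S := S) hbw0 hmomb 0 (subset_rfl : S ⊆ S)
    rwa [hcardS] at h
  -- shorthands for the target
  set Φ : Fin n → ℝ := fun i => (2 * Real.sqrt N + 1) * SV (q i) * exp (t / n * dia (q i)) * exp (-(t / n ^ 2 * Rad[ΛF, supp (q i)])) with hΦ
  have hgoal : cumBound (n + 1) * (1 + Ccov) * (MF + ∑ y ∈ ΛF, δF y) *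
      ∏ i, ((2 * Real.sqrt N + 1) * (∑ y ∈ supp (q i), lipV (q i) y) * exp (t / n * dia (q i)) * exp (-(t / n ^ 2 * Rad[ΛF, supp (q i)]))) =
      cumBound (n + 1) * (∏ i ∈ S, bw i) * ((1 + Ccov) * ∏ i, (exp (t / n * dia (q i)) * exp (-(t / n ^ 2 * Rad[ΛF, supp (q i)])))) := by
    rw [hprodS]
    have e : ∏ i, ((2 * Real.sqrt N + 1) * (∑ y ∈ supp (q i), lipV (q i) y) * exp (t / n * dia (q i)) * exp (-(t / n ^ 2 * Rad[ΛF, supp (q i)]))) =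
        (∏ i : Fin n, (2 * Real.sqrt N + 1) * SV (q i)) * ∏ i, (exp (t / n * dia (q i)) * exp (-(t / n ^ 2 * Rad[ΛF, supp (q i)]))) := by
      rw [← Finset.prod_mul_distrib]
      exact Fintype.prod_congr _ _ fun i => by simp only [hSV]; ring
    rw [e]; ring
  rw [hgoal]
  have hcb0 : 0 ≤ cumBound (n + 1) := (cumBound_pos _).le
  have hPbw0 : 0 ≤ ∏ i ∈ S, bw i := prod_nonneg fun i _ => hbw0 i
  have hK0 : 0 ≤ cumBound (n + 1) * ∏ i ∈ S, bw i := mul_nonneg hcb0 hPbw0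
  -- the exponential factor: radii
  have hrad_y : ∀ (i : Fin n), ∀ y ∈ supp (q i), linkSetDist ΛF y ≤ Rad[ΛF, supp (q i)] := fun i y hy => linkSetDist_le_rad hy
  -- case `n = 0` or some empty support: the crude bound suffices since the factor is `≥ 1` resp. the product vanishes
  by_cases hne : ∀ i : Fin n, (supp (q i)).Nonempty
  swap
  · obtain ⟨i, hi⟩ := not_forall.1 hne
    have hSVi : SV (q i) = 0 := by simp only [hSV, Finset.not_nonempty_iff_eq_empty.1 hi, sum_empty]
    have hzero : ∏ i ∈ S, bw i = 0 := by
      rw [hprodS]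
      exact mul_eq_zero_of_right _ (Finset.prod_eq_zero (Finset.mem_univ i) (by rw [hSVi, mul_zero]))
    rw [hzero, mul_zero, zero_mul]
    have := hcrude; rw [hzero, mul_zero] at this; exact this
  -- extremal links of each support
  have hmax : ∀ i : Fin n, ∃ y ∈ supp (q i), ∀ z ∈ supp (q i), linkSetDist ΛF z ≤ linkSetDist ΛF y := fun i =>
    Finset.exists_max_image (supp (q i)) (fun y => linkSetDist ΛF y) (hne i)
  have hmin : ∀ i : Fin n, ∃ y ∈ supp (q i), ∀ z ∈ supp (q i), linkSetDist ΛF y ≤ linkSetDist ΛF z := fun i =>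
    Finset.exists_min_image (supp (q i)) (fun y => linkSetDist ΛF y) (hne i)
  choose ymax hymax hmaxle using hmax
  choose ymin hymin hminle using hmin
  set hi : Fin n → ℝ := fun i => linkSetDist ΛF (ymax i) with hhi
  set lo : Fin n → ℝ := fun i => linkSetDist ΛF (ymin i) with hlo
  have hlohi : ∀ i, lo i ≤ hi i := fun i => hmaxle i _ (hymin i)
  have hlo0 : ∀ i, 0 ≤ lo i := fun i => linkSetDist_nonneg _ _
  have hradhi : ∀ i, Rad[ΛF, supp (q i)] = hi i := fun i =>
    le_antisymm (rad_le (linkSetDist_nonneg _ _) (hmaxle i)) (hrad_y i _ (hymax i))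
  -- spread ≤ diameter
  have hspread : ∀ i, hi i - lo i ≤ dia (q i) := fun i => by
    have h1 := linkSetDist_le_add_norm ΛF (ymax i) (ymin i)
    have h2 := hdia (q i) _ (hymax i) _ (hymin i)
    simp only [hhi, hlo]; linarith
  -- case `n = 0`
  rcases Nat.eq_zero_or_pos n with hn0 | hnpos
  · subst hn0
    have h1 : (1 : ℝ) ≤ (1 + Ccov) * ∏ i : Fin 0, (exp (t / (0 : ℕ) * dia (q i)) * exp (-(t / (0 : ℕ) ^ 2 * Rad[ΛF, supp (q i)]))) := by
      rw [Finset.univ_eq_empty, Finset.prod_empty, mul_one]; linarith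
    calc |trunc μ F Vc q| ≤ cumBound (0 + 1) * ∏ i ∈ S, bw i := hcrude
      _ = cumBound (0 + 1) * (∏ i ∈ S, bw i) * 1 := (mul_one _).symm
      _ ≤ _ := mul_le_mul_of_nonneg_left h1 hK0
  have hnR : (0 : ℝ) < n := by exact_mod_cast hnpos
  -- the top radius
  obtain ⟨i₀, -, hi₀max⟩ := Finset.exists_max_image (Finset.univ : Finset (Fin n)) hi ⟨⟨0, hnpos⟩, Finset.mem_univ _⟩
  have hi₀max' : ∀ i, hi i ≤ hi i₀ := fun i => hi₀max i (Finset.mem_univ i)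
  set Mstar := hi i₀ with hMstar
  set Ssp := ∑ i, (hi i - lo i) with hSsp
  -- the exponential factor dominates `e^{-(t/n)(M* - Ssp)}`
  have hexp_dom : exp (-(t / n * (Mstar - Ssp))) ≤ ∏ i, (exp (t / n * dia (q i)) * exp (-(t / n ^ 2 * Rad[ΛF, supp (q i)]))) := by
    have e1 : ∏ i, (exp (t / n * dia (q i)) * exp (-(t / n ^ 2 * Rad[ΛF, supp (q i)]))) =
        exp (∑ i, (t / n * dia (q i) - t / n ^ 2 * hi i)) := by
      rw [Real.exp_sum]
      exact Fintype.prod_congr _ _ fun i => by rw [hradhi i, ← Real.exp_add]; ring_nf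
    rw [e1]
    refine exp_le_exp.2 ?_
    have h1 : ∑ i, (t / n * dia (q i) - t / n ^ 2 * hi i) = t / n * ∑ i, dia (q i) - t / n ^ 2 * ∑ i, hi i := by
      rw [Finset.sum_sub_distrib, ← Finset.mul_sum, ← Finset.mul_sum]
    have h2 : ∑ i, hi i ≤ n * Mstar := by
      calc ∑ i, hi i ≤ ∑ _i : Fin n, Mstar := sum_le_sum fun i _ => hi₀max' i
        _ = n * Mstar := by rw [sum_const, Finset.card_univ, Fintype.card_fin, nsmul_eq_mul]
    have h3 : Ssp ≤ ∑ i, dia (q i) := sum_le_sum fun i _ => hspread i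
    have htn : 0 ≤ t / n := div_nonneg ht hnR.le
    have h4 : t / n ^ 2 * ∑ i, hi i ≤ t / n * Mstar := by
      have : t / n ^ 2 * (n * Mstar) = t / n * Mstar := by field_simp
      calc t / n ^ 2 * ∑ i, hi i ≤ t / n ^ 2 * (n * Mstar) := mul_le_mul_of_nonneg_left h2 (by positivity)
        _ = t / n * Mstar := this
    rw [h1]
    nlinarith [mul_le_mul_of_nonneg_left h3 htn]
  have h18 : (1 : ℝ) ≤ 1 + Ccov := by linarith
  have hfac0 : 0 ≤ ∏ i, (exp (t / n * dia (q i)) * exp (-(t / n ^ 2 * Rad[ΛF, supp (q i)]))) :=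
    prod_nonneg fun i _ => mul_nonneg (exp_pos _).le (exp_pos _).le
  by_cases hroom : Mstar ≤ Ssp
  · -- no room: the crude bound, the exponential factor is `≥ 1`
    have h1 : (1 : ℝ) ≤ (1 + Ccov) * ∏ i, (exp (t / n * dia (q i)) * exp (-(t / n ^ 2 * Rad[ΛF, supp (q i)]))) := by
      have h2 : (1 : ℝ) ≤ exp (-(t / n * (Mstar - Ssp))) := one_le_exp (by
        have : 0 ≤ t / n := div_nonneg ht hnR.le
        nlinarith)
      calc (1 : ℝ) = 1 * 1 := (mul_one _).symm
        _ ≤ _ := mul_le_mul h18 (h2.trans hexp_dom) zero_le_one (by positivity)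
    calc |trunc μ F Vc q| ≤ cumBound (n + 1) * ∏ i ∈ S, bw i := hcrude
      _ = cumBound (n + 1) * (∏ i ∈ S, bw i) * 1 := (mul_one _).symm
      _ ≤ _ := mul_le_mul_of_nonneg_left h1 hK0
  -- room: the radial pigeonhole cut
  replace hroom : Ssp < Mstar := not_le.1 hroom
  set θ : ℝ := (Mstar - Ssp) / n with hθ
  have hθpos : 0 < θ := div_pos (sub_pos.2 hroom) hnR
  have hhyp : 0 + ∑ i ∈ (Finset.univ : Finset (Fin n)), (hi i - lo i) + (Finset.univ : Finset (Fin n)).card * θ ≤ hi i₀ := by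
    rw [Finset.card_univ, Fintype.card_fin, hθ, zero_add, mul_div_cancel₀ _ hnR.ne']
    simp only [hSsp, hMstar]; linarith
  obtain ⟨u, hu0, hcut, j, -, hj⟩ := exists_radial_gap hθpos Finset.univ 0 i₀ (Finset.mem_univ _) (fun i _ => hlohi i) hhyp
  -- the cut predicate on slot indices: slot `0` and the supports below `u`
  obtain ⟨p, hp_def⟩ : ∃ p : ℕ → Prop, p = fun i => Nat.casesOn i True fun k => ∀ h : k < n, hi ⟨k, h⟩ ≤ u := ⟨_, rfl⟩
  have hp0 : p 0 := by rw [hp_def]; trivial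
  have hpsucc : ∀ (k : ℕ) (hk : k < n), p (k + 1) ↔ hi ⟨k, hk⟩ ≤ u := fun k hk => by
    rw [hp_def]; exact ⟨fun h => h hk, fun h _ => h⟩
  -- the gap between the two sides
  have hgap : ∀ i ∈ S, p i → ∀ i' ∈ S, ¬p i' → ∀ y ∈ Δs i, ∀ y' ∈ Δs i', θ ≤ ‖y.1 - y'.1‖ := by
    intro i hiS hpi i' hi'S hpi' y hy y' hy'
    -- the `¬p` slot is a direction slot `k'+1` with `hi k' > u`, hence `lo k' ≥ u + θ`
    obtain ⟨k', rfl⟩ : ∃ k', i' = k' + 1 := by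
      cases i' with
      | zero => exact absurd hp0 hpi'
      | succ k' => exact ⟨k', rfl⟩
    have hk' : k' < n := Nat.succ_lt_succ_iff.1 (Finset.mem_range.1 hi'S)
    have hy'mem : y' ∈ supp (q ⟨k', hk'⟩) := by rwa [hΔsucc, dif_pos hk'] at hy'
    have hfar : u + θ ≤ lo ⟨k', hk'⟩ := by
      rcases hcut ⟨k', hk'⟩ (Finset.mem_univ _) with h | h
      · exact absurd ((hpsucc k' hk').2 h) hpi'
      · exact h
    have hy'lo : u + θ ≤ linkSetDist ΛF y' := hfar.trans (hminle _ _ hy'mem)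
    -- the `p` slot has all its links within `u` of `Λ_F`
    have hyu : linkSetDist ΛF y ≤ u := by
      cases i with
      | zero =>
        rw [hΔ0] at hy
        rw [linkSetDist_eq_zero_of_mem hy]; exact hu0
      | succ k =>
        have hk : k < n := Nat.succ_lt_succ_iff.1 (Finset.mem_range.1 hiS)
        have hymem : y ∈ supp (q ⟨k, hk⟩) := by rwa [hΔsucc, dif_pos hk] at hy
        exact (hmaxle _ _ hymem).trans ((hpsucc k hk).1 hpi)
    have htri := linkSetDist_le_add_norm ΛF y' y
    rw [norm_sub_rev] at htri
    linarith
  -- both sides are occupied: slot `0` is `p`, slot `j+1` is `¬p`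
  have hSp : (S.filter p).Nonempty := ⟨0, Finset.mem_filter.2 ⟨Finset.mem_range.2 (Nat.succ_pos n), hp0⟩⟩
  have hnotp : ¬p (j.1 + 1) := fun hpj => by
    have h1 : hi j ≤ u := (hpsucc j.1 j.2).1 hpj
    linarith [hlohi j]
  have hSn : (S.filter fun i => ¬p i).Nonempty :=
    ⟨j.1 + 1, Finset.mem_filter.2 ⟨Finset.mem_range.2 (Nat.succ_lt_succ j.2), hnotp⟩⟩
  -- the split lemma
  have hsplit := abs_moment_split_le_of_covDecay hCcov ht hCov (S := S) (X := X) (Δ := Δs) (M := Ms) (δ := δs)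
    (fun i _ => hXm i) (fun i _ => hXdep i) (fun i _ => hXM i) (fun i _ => hXδ i) p hgap
  have hε0 : 0 ≤ Ccov * exp (-(t * θ)) := mul_nonneg hCcov (exp_pos _).le
  have hkey := abs_ac_le_of_split p (m := mom μ X) (S := S) (a := 0) (b := bw) hbw0 hε0 hmom1 hmomb
    (fun T hT => by simpa only [mom, hbw] using hsplit T hT) (Finset.mem_range.2 (Nat.succ_pos n)) hSp hSn
  rw [hcardS] at hkey
  -- `e^{-tθ} = e^{-(t/n)(M* - Ssp)}`
  have hθeq : t * θ = t / n * (Mstar - Ssp) := by rw [hθ]; field_simp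
  calc |trunc μ F Vc q| = |ac (mom μ X) 0 S| := rfl
    _ ≤ cumBound (n + 1) * (Ccov * exp (-(t * θ))) * ∏ i ∈ S, bw i := hkey
    _ = cumBound (n + 1) * (∏ i ∈ S, bw i) * (Ccov * exp (-(t / n * (Mstar - Ssp)))) := by rw [hθeq]; ring
    _ ≤ cumBound (n + 1) * (∏ i ∈ S, bw i) * ((1 + Ccov) * ∏ i, (exp (t / n * dia (q i)) * exp (-(t / n ^ 2 * Rad[ΛF, supp (q i)])))) := by
        refine mul_le_mul_of_nonneg_left ?_ hK0
        exact mul_le_mul (by linarith) hexp_dom (exp_pos _).le (by positivity)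

end SUN

end Summit.Ventures.YMGap.RobustBall

end
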